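import Literature.MathematicalPhysics.QuantumFieldTheory.Balaban1983to89.B9GeoLemma21KLevelV1
import Literature.MathematicalPhysics.QuantumFieldTheory.Balaban1983to89.B9GeoNormsKLevelModelSignsV1

/-!
# `Balaban1983to89.B9Ineq349DimConstant` — [B9] (3.49) p. 399: the (3.25)-in-kernels dictionary `Dict349` of the whole
# printed leaf `B9.Stmt349Printed` WITH A DIMENSION CONSTANT (𝔤-valued operators read on product-form arguments), by
# SCALING the typed readings — and row 25 at the record geometry `geo9Y` in one call

T. Bałaban, *Propagators for lattice gauge theories in a background field*, Commun. Math. Phys. **99** (1985) 389–434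
[`Balaban1985BackgroundPropagators`, "B9"]; [4] = T. Bałaban, *Propagators and renormalization transformations for lattice
gauge theories. II*, Commun. Math. Phys. **96** (1984) 223–250 [`Balaban1984PropagatorsII`].

statement-level skeleton of published theorems with citation tags; proofs where landed; nothing here is a claim about the
Yang–Mills mass gap

THE PRINTED LOCUS (verbatim, p. 399 [PDF 11]).  *"These theorems imply all the properties of the operator R, or DRD\*, we will
need in the future. For the operator P = I − R we obtain, using again Lemma 2.1, \[|P(x, x′)|, …\] ≦ O(1)\[1, (L^jη)^{−1},
(L^jη)^{−1}, (L^jη)^{−2}\](L^{j′}η)^{−d}e^{−(1/2)δ₀d(y,y′)} … (3.49)"*, P = G′Q′\*(Q′G′²Q′\*)^{−1}Q′G′ by (3.25) p. 394; the entries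
of P, G′ are End(𝔤)-valued for U ≠ 1, |·| the operator norm on 𝔤 (cell GAPS G-B9-12).

THE POINT.  Row 25 of the N06 knit is inhabited by `B9Ineq349Whole.stmt349Printed_of_thm31_thm32` (p461761) from Theorems 3.1,
3.2 as typed plus the located dictionary `B9Ineq349Whole.Dict349 Gp Cinv P`: at every U there are outer kernels K₁, K₃ with
`B9Ineq349.CompDominated` (the (3.49)-entries of P ≦ the plain double sum K₁·|Cinv|·K₃ — sound for End(𝔤)-blocks, operator norms
being submultiplicative) and `B9Ineq349.ObservedBy Gp U m K` — *"∃ ONE argument λ ⊂ Δ(y₁), |λ| ≦ 1, with |K(y, y₁)| ≦ Gp.e m U λ y"*,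
WITHOUT a constant.  At a non-abelian instance whose Theorem-3.1 readings are taken on PRODUCT-FORM arguments λ ⊗ E (λ scalar,
E in the unit ball of 𝔸 — the reading of `Node00.OpsYOfLetters`, whose header says *"print's bounds for all 𝔸-valued λ and for all
product-form λ agree up to a dimension constant"*), the left factor of (3.25), E ↦ (G′(U)Q′(U)\*(δ_s ⊗ E))(x), is G′ applied to a
NON-product-form function (its 𝔤-direction rotates with the site through the averaging transporters); expanding in a basis of 𝔸
bounds it by a SUM of dim 𝔸 product-form readings, i.e. by dim 𝔸 times ONE reading — so `ObservedBy` is met only up to a dimension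
constant, and `Dict349` as typed (c = 1) is in general not the shape such an instance meets.  THIS FILE types the dictionary WITH A
CONSTANT and shows it costs nothing but the constant, by the homogeneity of the typed blocks (3.42)–(3.47) in the readings:

* §1 `scaleKF c K` — the kernel-family reading with every entry multiplied by c; `ineq342_346_347_scaleKF`, `ineq343_345_scaleKF`
  (c ≧ 0: the blocks of Theorem 3.1 for K with B₀, B₀(β), B′₀(ε), B′₀(ε, β) give them for `scaleKF c K` with the constants × c),
  `thm31Printed_scaleKF` (c > 0: `B9.Thm31Printed` for Gp ⟹ for the scaled family).
* §2 `ObservedByWith c Gp U m K` (|K(y, y₁)| ≦ c·Gp.e m U λ y), `Dict349With c Gp Cinv P`; `observedByWith_iff` ∕ `dict349With_iff`: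
  they ARE `ObservedBy` ∕ `Dict349` of the scaled reading (`Iff.rfl`); `dict349With_one_iff`: c = 1 is g0's `Dict349` (conservative).
* §3 ★ `stmt349Printed_of_thm31_thm32_with` — THE WHOLE PRINTED LEAF from Theorems 3.1∕3.2 as typed, the model signs, `DistOK`, a common
  L, `LevelGap`, `RowSum261` and `Dict349With c` (c > 0): p461761's theorem at the scaled reading (its O(1) gains the factor c²).
* §4 ★ AT THE RECORD GEOMETRY `geo9Y` in one call: `stmt349Printed_geo9Y_of_thm31_thm32_with` (binders: `hc`, `h31`, `h32`, `hdict`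
  only — the model signs by `modelSignsOn_geo9K` on the argument family `isRight` of the knit, `DistOK ∕ L = ℓ+1 ∕ LevelGap 1 ∕ RowSum261`
  by p467804's `distOK_geo9Y ∕ rfl ∕ levelGap_geo9Y_one ∕ rowSum261_geo9Y`) and its c-free twin `stmt349Printed_geo9Y_of_thm31_thm32`
  (= the combination the knit's `…ObligationsS349` link makes inline, by name).

HONEST SCOPE.  Nothing of print is asserted: Theorems 3.1∕3.2 and the dictionary (with or without constant) are HYPOTHESES; the file
is kernel-checked bookkeeping (homogeneity under scaling) making row 25's residual binder meetable by a non-abelian instance.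
NOT a node discharge, NOT summit progress; one finite lattice programme; nothing continuum, nothing about the mass gap.  Cell
`pub-ymgap` (HUMAN RULING D-0062), Track A node N06 [B9], N06-ASSIGNMENT v1 row 25 (bundle F4), seat `pub-ymgap-dag-n06-i` gen 3,
2026-08-26.
-/

namespace Literature.MathematicalPhysics.QuantumFieldTheory.Balaban1983to89.B9Ineq349DimConstant

open B9Ineq349 (CompDominated ObservedBy entL entR)
open B9Ineq349Whole (Dict349 DistOK LevelGap RowSum261 stmt349Printed_of_thm31_thm32)
open B9FromB6ModelSignsOn (ModelSignsOn)

noncomputable section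

/-! ## §1 Scaling the readings: the typed blocks of Theorem 3.1 are homogeneous -/

section Scale

variable {g : B9.Geometry} {B : B9.Backgrounds}

/-- **THE SCALED READING**: the kernel family with every entry ((3.42) sups, (3.43)∕(3.45) Hölder members, (3.44), (3.46) L² quantities,
(3.47) global norms) multiplied by the constant c — the device by which a dictionary «up to a dimension constant c» becomes the typed
dictionary of another reading. [cite: Balaban1985BackgroundPropagators, Thm 3.1 (3.42)–(3.47) pp.397–398 (the quantities), bookkeeping] -/
def scaleKF (c : ℝ) (K : B9.KernelFamily g B) : B9.KernelFamily g B where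
  e := fun n U lam y => c * K.e n U lam y
  h1 := fun U lam β ζ => c * K.h1 U lam β ζ
  e4 := fun U lam y => c * K.e4 U lam y
  h2 := fun U lam β ζ => c * K.h2 U lam β ζ
  l2 := fun n U lam h => c * K.l2 n U lam h
  glob := fun n U lam γ => c * K.glob n U lam γ

/-- the scaled (3.42) entry, unfolded. [cite: Balaban1985BackgroundPropagators, (3.42) p.397, bookkeeping] -/
@[simp] theorem scaleKF_e (c : ℝ) (K : B9.KernelFamily g B) (n : Fin 4) (U : B.Cfg) (lam : g.Loc) (y : g.Site) :
    (scaleKF c K).e n U lam y = c * K.e n U lam y := rfl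

/-- **(3.42) + (3.46) + (3.47) ARE HOMOGENEOUS IN THE READING**: the block for K with (B₀, δ₀) at U gives the block for `scaleKF c K` with
(c·B₀, δ₀), c ≧ 0. [cite: Balaban1985BackgroundPropagators, Thm 3.1 (3.42), (3.46), (3.47) pp.397–398 (bookkeeping: homogeneity)] -/
theorem ineq342_346_347_scaleKF {c : ℝ} (hc : 0 ≤ c) {K : B9.KernelFamily g B} {B₀ δ₀ : ℝ} {U : B.Cfg}
    (h : B9.Ineq342_346_347 K B₀ δ₀ U) : B9.Ineq342_346_347 (scaleKF c K) (c * B₀) δ₀ U := by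
  obtain ⟨h1, h2, h3⟩ := h
  refine ⟨fun n lam y y' hs => ?_, fun n lam hh y y' hh' hs => ?_, fun n lam γ hγ hγ' => ?_⟩
  · calc (scaleKF c K).e n U lam y = c * K.e n U lam y := rfl
      _ ≤ c * (B₀ * B9.pref4 (g.len y) n * Real.exp (-(δ₀ * g.dist y y')) * g.supNorm lam) :=
          mul_le_mul_of_nonneg_left (h1 n lam y y' hs) hc
      _ = c * B₀ * B9.pref4 (g.len y) n * Real.exp (-(δ₀ * g.dist y y')) * g.supNorm lam := by ring
  · calc (scaleKF c K).l2 n U lam hh = c * K.l2 n U lam hh := rfl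
      _ ≤ c * (B₀ * B9.pref6 (g.len y) n * g.cutSup hh * Real.exp (-(δ₀ * g.dist y y')) * g.l2Norm lam) :=
          mul_le_mul_of_nonneg_left (h2 n lam hh y y' hh' hs) hc
      _ = c * B₀ * B9.pref6 (g.len y) n * g.cutSup hh * Real.exp (-(δ₀ * g.dist y y')) * g.l2Norm lam := by ring
  · calc (scaleKF c K).glob n U lam γ = c * K.glob n U lam γ := rfl
      _ ≤ c * (B₀ * g.wNorm γ lam) := mul_le_mul_of_nonneg_left (h3 n lam γ hγ hγ') hc
      _ = c * B₀ * g.wNorm γ lam := by ring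

/-- **(3.43)–(3.45) ARE HOMOGENEOUS IN THE READING**: the Hölder block for K with B₀(β), B′₀(ε), B′₀(ε, β) gives it for `scaleKF c K` with the
three constant functions × c, c ≧ 0. [cite: Balaban1985BackgroundPropagators, Thm 3.1 (3.43)–(3.45) p.398 (bookkeeping: homogeneity)] -/
theorem ineq343_345_scaleKF {c : ℝ} (hc : 0 ≤ c) {K : B9.KernelFamily g B} {Bβ Bε : ℝ → ℝ} {Bεβ : ℝ → ℝ → ℝ} {δ₀ : ℝ}
    {U : B.Cfg} (h : B9.Ineq343_345 K Bβ Bε Bεβ δ₀ U) :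
    B9.Ineq343_345 (scaleKF c K) (fun β => c * Bβ β) (fun ε => c * Bε ε) (fun ε β => c * Bεβ ε β) δ₀ U := by
  obtain ⟨h1, h2, h3⟩ := h
  refine ⟨fun β lam ζ y y' hβ hβ' hζ hs => ?_, fun ε lam y y' hε hε' hs => ?_,
    fun ε β lam ζ y y' hε hε' hβ hβ' hζ hs => ?_⟩
  · calc (scaleKF c K).h1 U lam β ζ = c * K.h1 U lam β ζ := rfl
      _ ≤ c * (Bβ β * g.len y ^ (1 - β) * g.cutH β ζ * Real.exp (-(δ₀ * g.dist y y')) * g.supNorm lam) :=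
          mul_le_mul_of_nonneg_left (h1 β lam ζ y y' hβ hβ' hζ hs) hc
      _ = c * Bβ β * g.len y ^ (1 - β) * g.cutH β ζ * Real.exp (-(δ₀ * g.dist y y')) * g.supNorm lam := by ring
  · calc (scaleKF c K).e4 U lam y = c * K.e4 U lam y := rfl
      _ ≤ c * (Bε ε * Real.exp (-(δ₀ * g.dist y y')) * (g.holder ε lam + g.supNorm lam)) :=
          mul_le_mul_of_nonneg_left (h2 ε lam y y' hε hε' hs) hc
      _ = c * Bε ε * Real.exp (-(δ₀ * g.dist y y')) * (g.holder ε lam + g.supNorm lam) := by ring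
  · calc (scaleKF c K).h2 U lam β ζ = c * K.h2 U lam β ζ := rfl
      _ ≤ c * (Bεβ ε β * g.len y ^ (-β) * g.cutH β ζ * Real.exp (-(δ₀ * g.dist y y')) *
            (g.holder (β + ε) lam + g.supNorm lam)) :=
          mul_le_mul_of_nonneg_left (h3 ε β lam ζ y y' hε hε' hβ hβ' hζ hs) hc
      _ = c * Bεβ ε β * g.len y ^ (-β) * g.cutH β ζ * Real.exp (-(δ₀ * g.dist y y')) *
            (g.holder (β + ε) lam + g.supNorm lam) := by ring

end Scale

section ScaleFamily

variable {I : Type} {c35 : ℝ} {geo : I → B9.Geometry} {bg : I → B9.Backgrounds}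

/-- **THEOREM 3.1 AS TYPED PASSES TO THE SCALED READINGS** (c > 0): the same thresholds M₁, a₀ and rate δ₀, constants × c.
[cite: Balaban1985BackgroundPropagators, Thm 3.1 (3.42)–(3.47) pp.397–398 (bookkeeping: homogeneity)] -/
theorem thm31Printed_scaleKF {c : ℝ} (hc : 0 < c) {Gp : ∀ i, B9.KernelFamily (geo i) (bg i)}
    (h : B9.Thm31Printed c35 geo bg Gp) : B9.Thm31Printed c35 geo bg (fun i => scaleKF c (Gp i)) := by
  obtain ⟨M₁, δ₀, a₀, B₀, Bβ, Bε, Bεβ, hM₁, hδ₀, ha₀, hB₀, H⟩ := h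
  refine ⟨M₁, δ₀, a₀, c * B₀, fun β => c * Bβ β, fun ε => c * Bε ε, fun ε β => c * Bεβ ε β, hM₁, hδ₀, ha₀,
    mul_pos hc hB₀, fun i hM α₀ hα₀ hMa U hU => ?_⟩
  obtain ⟨h342, h343⟩ := H i hM α₀ hα₀ hMa U hU
  exact ⟨ineq342_346_347_scaleKF hc.le h342, ineq343_345_scaleKF hc.le h343⟩

end ScaleFamily

/-! ## §2 The dictionary with a constant -/

section WithConstant

variable {g : B9.Geometry} {B : B9.Backgrounds}

/-- **AN OUTER KERNEL OBSERVED BY AN ENTRY OF (3.42) UP TO THE CONSTANT c**: for all y, y₁ there is ONE argument λ localised in Δ(y₁) with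
|λ| ≦ 1 and |K(y, y₁)| ≦ c·(the m-th (3.42)-reading of G′ at U on λ, observed at y) — the shape a 𝔤-valued factor kernel meets against
product-form readings with c = the dimension constant (`B9Ineq349.ObservedBy` is c = 1).  Located hypothesis shape, not printed.
[cite: Balaban1985BackgroundPropagators, (3.25) p.394 with (3.42) p.397 (dictionary shape)] -/
def ObservedByWith (c : ℝ) (Gp : B9.KernelFamily g B) (U : B.Cfg) (m : Fin 4) (K : g.Site → g.Site → ℝ) : Prop :=
  ∀ y y₁ : g.Site, ∃ lam : g.Loc, g.suppIn lam y₁ ∧ g.supNorm lam ≤ 1 ∧ |K y y₁| ≤ c * Gp.e m U lam y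

/-- observed up to c IS observed by the scaled reading. [cite: Balaban1985BackgroundPropagators, (3.42) p.397 (bookkeeping)] -/
theorem observedByWith_iff (c : ℝ) (Gp : B9.KernelFamily g B) (U : B.Cfg) (m : Fin 4) (K : g.Site → g.Site → ℝ) :
    ObservedByWith c Gp U m K ↔ ObservedBy (scaleKF c Gp) U m K := Iff.rfl

variable [Fintype g.Site]

/-- **THE (3.25)-IN-KERNELS DICTIONARY WITH A CONSTANT** (located hypothesis shape): at every U there are outer kernels K₁, K₃ with
`B9Ineq349.CompDominated Cinv P U K₁ K₃` (the (3.49)-entries of P ≦ the plain double sum K₁·|Cinv|·K₃ of (3.25)) whose kernels are observed by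
the entries `entL n`, `entR n` of (3.42) UP TO THE CONSTANT c (`ObservedByWith c`).  `B9Ineq349Whole.Dict349` is c = 1.
[cite: Balaban1985BackgroundPropagators, (3.25) p.394 with (3.42) p.397 and (3.48)–(3.49) pp.398–399 (dictionary shape)] -/
def Dict349With (c : ℝ) (Gp : B9.KernelFamily g B) (Cinv : B9.SiteKernel g B) (P : B9.FineKernel g B) : Prop :=
  ∀ U : B.Cfg, ∃ K₁ K₃ : Fin 4 → g.Site → g.Site → ℝ,
    CompDominated Cinv P U K₁ K₃ ∧ (∀ n : Fin 4, ObservedByWith c Gp U (entL n) (K₁ n)) ∧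
      (∀ n : Fin 4, ObservedByWith c Gp U (entR n) (fun y' y₂ => K₃ n y₂ y'))

/-- the dictionary with constant c IS g0's dictionary of the scaled reading. [cite: Balaban1985BackgroundPropagators, (3.25) p.394 (bookkeeping)] -/
theorem dict349With_iff (c : ℝ) (Gp : B9.KernelFamily g B) (Cinv : B9.SiteKernel g B) (P : B9.FineKernel g B) :
    Dict349With c Gp Cinv P ↔ Dict349 (scaleKF c Gp) Cinv P := Iff.rfl

/-- c = 1 is g0's dictionary — the extension is conservative. [cite: Balaban1985BackgroundPropagators, (3.25) p.394 (bookkeeping)] -/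
theorem dict349With_one_iff (Gp : B9.KernelFamily g B) (Cinv : B9.SiteKernel g B) (P : B9.FineKernel g B) :
    Dict349With 1 Gp Cinv P ↔ Dict349 Gp Cinv P := by
  simp only [Dict349With, Dict349, ObservedByWith, ObservedBy, one_mul]

end WithConstant

/-! ## §3 The whole printed leaf from the dictionary with a constant -/

section Family

variable {I : Type} {c35 : ℝ} {geo : I → B9.Geometry} {bg : I → B9.Backgrounds} [∀ i, Fintype (geo i).Site]

/-- ★ **(3.49) AS THE WHOLE PRINTED LEAF `B9.Stmt349Printed` FROM THE DICTIONARY WITH A DIMENSION CONSTANT**: Theorem 3.1 as typed for the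
readings `Gp`, Theorem 3.2 as typed for `Cinv`, the model signs per member on any sub-family of arguments, `DistOK` per member, one L for
the family, [4] Lemma 2.1 as `LevelGap geo R` (R > 0) and `RowSum261 geo`, and the dictionary `Dict349With c` per member (c > 0) give
`B9.Stmt349Printed d c35 geo bg P` — `B9Ineq349Whole.stmt349Printed_of_thm31_thm32` (p461761) at the SCALED readings `scaleKF c (Gp i)`
(`thm31Printed_scaleKF`, `dict349With_iff`); the O(1) of p461761 with B₀ ↦ c·B₀.  Nothing of print asserted; NOT a node discharge.
[cite: Balaban1985BackgroundPropagators, (3.49) p.399 + Thm 3.1 (3.42) p.397 + Thm 3.2 (3.48) p.398; Balaban1984PropagatorsII, Lemma 2.1 (2.59)–(2.61) pp.233–234] -/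
theorem stmt349Printed_of_thm31_thm32_with (d : ℕ) {c : ℝ} (hc : 0 < c) {Gp : ∀ i, B9.KernelFamily (geo i) (bg i)}
    {Cinv : ∀ i, B9.SiteKernel (geo i) (bg i)} {P : ∀ i, B9.FineKernel (geo i) (bg i)}
    (h31 : B9.Thm31Printed c35 geo bg Gp) (h32 : B9.Thm32Printed d c35 geo bg Cinv)
    {Q : ∀ i, (geo i).Loc → Prop} (S : ∀ i, ModelSignsOn (geo i) (Q i)) (D : ∀ i, DistOK (geo i))
    {L : ℝ} (hL : 1 ≤ L) (hLi : ∀ i, (geo i).L = L) {R : ℝ} (hR : 0 < R) (hgap : LevelGap geo R)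
    (h261 : RowSum261 geo)
    (hdict : ∀ i, Dict349With c (Gp i) (Cinv i) (P i)) :
    B9.Stmt349Printed d c35 geo bg P :=
  stmt349Printed_of_thm31_thm32 (Gp := fun i => scaleKF c (Gp i)) d (thm31Printed_scaleKF hc h31) h32 S D hL hLi hR hgap h261
    fun i => (dict349With_iff c (Gp i) (Cinv i) (P i)).1 (hdict i)

end Family

/-! ## §4 Row 25 at the record geometry `geo9Y`, in one call -/

section Record

open B9PinMembersKLevelV1 (MemberY geo9Y)
open B9GeoLemma21KLevelV1 (distOK_geo9Y levelGap_geo9Y_one rowSum261_geo9Y)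
open B9GeoNormsKLevelModelSignsV1 (modelSignsOn_geo9K)

variable {d ℓ : ℕ} {hd : 1 ≤ d + 1} {hL : Odd (ℓ + 1) ∧ 1 < ℓ + 1} {b₀ b₁ : ℝ} {Mstar : ℕ}

/-- ★ **ROW 25 AT THE RECORD GEOMETRY FROM THEOREMS 3.1∕3.2 AS TYPED AND THE DICTIONARY WITH A DIMENSION CONSTANT** (the shape a
non-abelian instance meets): over the members `MemberY` with their realised geometry `geo9Y` (ANY backgrounds record `bg`, `c35`, readings
`Gp`, `Cinv`, `P`, ANY `Fintype` instance as the knit binds it), `B9.Thm31Printed c35 geo9Y bg Gp`, `B9.Thm32Printed d′ c35 geo9Y bg Cinv` and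
`Dict349With c (Gp x) (Cinv x) (P x)` per member (c > 0) give `B9.Stmt349Printed d′ c35 geo9Y bg P`.  Discharged here: the model signs on the
knit's argument family `isRight` (`modelSignsOn_geo9K`), `DistOK` (`distOK_geo9Y`), the common `L = ℓ + 1` (`rfl`), `LevelGap geo9Y 1`
(`levelGap_geo9Y_one`), `RowSum261 geo9Y` (`rowSum261_geo9Y`).  In the N06 knit: `s349 := stmt349Printed_geo9Y_of_thm31_thm32_with (θ.d₆+1) hc h31 h32 hdict`.
[cite: Balaban1985BackgroundPropagators, (3.49) p.399 + Thm 3.1 p.397 + Thm 3.2 p.398; Balaban1984PropagatorsII, Lemma 2.1 (2.59)–(2.61) pp.233–234] -/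
theorem stmt349Printed_geo9Y_of_thm31_thm32_with (dd : ℕ) [∀ x : MemberY d ℓ hd hL b₀ b₁ Mstar, Fintype (geo9Y x).Site]
    {c : ℝ} (hc : 0 < c) {c35 : ℝ} {bg : MemberY d ℓ hd hL b₀ b₁ Mstar → B9.Backgrounds}
    {Gp : ∀ x : MemberY d ℓ hd hL b₀ b₁ Mstar, B9.KernelFamily (geo9Y x) (bg x)}
    {Cinv : ∀ x : MemberY d ℓ hd hL b₀ b₁ Mstar, B9.SiteKernel (geo9Y x) (bg x)}
    {P : ∀ x : MemberY d ℓ hd hL b₀ b₁ Mstar, B9.FineKernel (geo9Y x) (bg x)}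
    (h31 : B9.Thm31Printed c35 geo9Y bg Gp) (h32 : B9.Thm32Printed dd c35 geo9Y bg Cinv)
    (hdict : ∀ x : MemberY d ℓ hd hL b₀ b₁ Mstar, Dict349With c (Gp x) (Cinv x) (P x)) :
    B9.Stmt349Printed dd c35 (geo9Y (d := d) (ℓ := ℓ) (hd := hd) (hL := hL) (b₀ := b₀) (b₁ := b₁) (Mstar := Mstar)) bg P :=
  stmt349Printed_of_thm31_thm32_with dd hc h31 h32 (Q := fun _ lam => lam.isRight = true)
    (fun x => modelSignsOn_geo9K x.toKIdx) (fun x => distOK_geo9Y x) (L := ((ℓ + 1 : ℕ) : ℝ))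
    (by exact_mod_cast Nat.succ_le_succ (Nat.zero_le ℓ)) (fun _ => rfl) one_pos levelGap_geo9Y_one rowSum261_geo9Y hdict

/-- ★ **ROW 25 AT THE RECORD GEOMETRY, c-FREE TWIN** (g0's dictionary `Dict349`, i.e. c = 1 — the abelian ∕ scalar-reading case): the
combination the knit's `…ObligationsS349` link makes inline, by name and in one call — binders `h31`, `h32`, `hdict` only.
[cite: Balaban1985BackgroundPropagators, (3.49) p.399 + Thm 3.1 p.397 + Thm 3.2 p.398; Balaban1984PropagatorsII, Lemma 2.1 (2.59)–(2.61) pp.233–234] -/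
theorem stmt349Printed_geo9Y_of_thm31_thm32 (dd : ℕ) [∀ x : MemberY d ℓ hd hL b₀ b₁ Mstar, Fintype (geo9Y x).Site]
    {c35 : ℝ} {bg : MemberY d ℓ hd hL b₀ b₁ Mstar → B9.Backgrounds}
    {Gp : ∀ x : MemberY d ℓ hd hL b₀ b₁ Mstar, B9.KernelFamily (geo9Y x) (bg x)}
    {Cinv : ∀ x : MemberY d ℓ hd hL b₀ b₁ Mstar, B9.SiteKernel (geo9Y x) (bg x)}
    {P : ∀ x : MemberY d ℓ hd hL b₀ b₁ Mstar, B9.FineKernel (geo9Y x) (bg x)}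
    (h31 : B9.Thm31Printed c35 geo9Y bg Gp) (h32 : B9.Thm32Printed dd c35 geo9Y bg Cinv)
    (hdict : ∀ x : MemberY d ℓ hd hL b₀ b₁ Mstar, Dict349 (Gp x) (Cinv x) (P x)) :
    B9.Stmt349Printed dd c35 (geo9Y (d := d) (ℓ := ℓ) (hd := hd) (hL := hL) (b₀ := b₀) (b₁ := b₁) (Mstar := Mstar)) bg P :=
  stmt349Printed_geo9Y_of_thm31_thm32_with dd one_pos h31 h32 fun x => (dict349With_one_iff (Gp x) (Cinv x) (P x)).2 (hdict x)

end Record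

end

end Literature.MathematicalPhysics.QuantumFieldTheory.Balaban1983to89.B9Ineq349DimConstant
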